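import Summits.FinalStateConjecture.FinalStateConjecture.Theses.RenormalisedDrift
import Summits.FinalStateConjecture.FinalStateConjecture.Theses.PhaseMixingCapture
import Summits.FinalStateConjecture.FinalStateConjecture.Theses.TangentProfileCensorship
import Literature.Geometry.Lorentzian.TameGenericityLocal
import Literature.Geometry.Lorentzian.TameGenericityDiagonal
import Literature.Geometry.Lorentzian.AdmissibleMGHDExistence

/-!
# `AdiabaticTracking` (stmt-FinalStateConjecture-17504, route RenormalisedDrift, rank 3):
# where the crux and the four registered stubs of line `registered` sit in the item lattice

Helper file of the line lead (crux `RenormalisedDrift.AdiabaticTracking`; skeleton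
`Cruxes/AdiabaticTracking/Lines/birth.lean`, stubs `stub_mghdExists` (S0),
`stub_weakCosmicCensorship` (S1), `stub_trackedLandingAlongCensoredCurves` (S2),
`stub_trackingEscapeInsideCensored` (S3)). Everything here is sorry-free, definition-free pure logic;
the hypotheses are EXISTING route items BY NAME, the Literature named fact
`choquetBruhat_geroch_exists_mghd_cauchy`, the registered stub signatures written out verbatim (the
skeleton is a crux workfile and is not importable), or the ONE new statement this file isolates, the
WINDOW BRIDGE, written out verbatim as a hypothesis wherever it is used:

  for every admissible datum, every maximal vacuum Cauchy development with complete `𝓘⁺` which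
  settles down in the summit's honest sense (a `C²` sub-extremal `FinalStateDecomposition d` of
  `O = exteriorOf 𝒟 d.charted` with `RaysStayInClosure`, `HasExhaustiveCharts`, `IsFutureOriented`)
  is adiabatically tracked at EVERY accuracy with one complexity `(N, m₀ > 0, χ < 1)`.

The window bridge is the pointwise converse companion of this route's rank-2 crux `DriftCapture`
(tracked at every accuracy ⇒ settles honestly). It is NOT a formal consequence of the decomposition's
data: `FinalStateDecomposition.eventually_nonempty_approximateKerrConfiguration` leaves the window
covering clause and the excision bound as hypotheses, the windows must be re-anchored to chart time
`0`, and the CHAINING clause of `IsAdiabaticallyTracked` with radii `Rₙ → ∞` cannot be met by the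
decomposition's own charts when `N ≥ 2` holes recede with non-zero asymptotic velocities (the boosted
Kerr–Schild start discs of window `n + 1` tilt out of the rigid flat slab of window `n` once
`|vᵢ| Rₙ ≳ L`); on paper one re-coordinatises the late region by a flat chart co-moving with every
hole locally (boost field of gradient `≲ ε / L`, available once the holes are `≳ |Δv| L / ε` apart).
So the bridge is geometry (late adapted coordinates + causal character of the certified leaves), an
XL formalisation, not an open problem of the theory; it is recorded here, never asserted.

* Crux level. `adiabaticTracking_of_legs` (the line's composition `AdiabaticTracking_of` in
  hypothetical form: S0 → S1 → S2 → S3 → crux); `weakCosmicCensorshipTame_of_adiabaticTracking`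
  (NECESSITY record: the crux implies item stmt-17269 `PhaseMixingCapture.WeakCosmicCensorshipTame`,
  hence `weakCosmicCensorshipMGHD_of_adiabaticTracking`, item stmt-9952);
  `adiabaticTracking_of_finalStateConjecture_of_windowBridge` (summit ∧ bridge ⇒ crux), hence
  `adiabaticTracking_iff_finalStateConjecture` GRANTED the bridge and `DriftCapture` (modulo the two
  converse bridges the crux IS the summit), and `adiabaticTracking_of_tameExits_of_windowBridge`
  (crux ⇐ bridge ∧ stmt-9937 ∧ stmt-17383 ∧ stmt-17348, through `TangentProfileCensorship.closes`).
* Stub level (each registered signature verbatim).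
  - S0: `stub_mghdExists_iff_mghdExists` (`Iff.rfl` with this route's item stmt-9937 `MGHDExists`),
    `stub_mghdExists_of_choquetBruhatGeroch` (one line from the CBG named fact);
  - S1 (LOCAL expanded form, unlike the `IsTameChristodoulouGeneric` form registered on the sibling
    cruxes): `stub_weakCosmicCensorship_of_adiabaticTracking` (necessity),
    `stub_weakCosmicCensorship_of_weakCosmicCensorshipTame` (⇐ stmt-17269, `ε = 1`),
    `stub_weakCosmicCensorship_of_nakedDataTameExit` (⇐ stmt-17383);
  - S2: `stub_trackedLandingAlongCensoredCurves_of_adiabaticTracking` (necessity),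
    `stub_trackedLandingAlongCensoredCurves_of_nakedDataTameExit_of_windowBridge` (⇐ stmt-17383 ∧ bridge);
  - S3: `stub_trackingEscapeInsideCensored_of_adiabaticTracking` (necessity),
    `stub_trackingEscapeInsideCensored_of_censoredDataTameExit_of_windowBridge` (⇐ stmt-17348 ∧ bridge).

So modulo the window bridge (and the CBG fact for S0) the line's stubs ARE the two
TangentProfileCensorship exits: S1, S2 ⇐ stmt-17383, S3 ⇐ stmt-17348; and no stub can die unless the
crux dies (each is implied by it). Nothing here is analysis; all genericity / stability / tracking
content sits in the named hypotheses.
-/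

-- the doubled `FinalStateConjecture.FinalStateConjecture` path component trips dupNamespace
set_option linter.dupNamespace false

noncomputable section

open scoped Manifold ContDiff Topology
open Set Function

namespace Summit.FinalStateConjecture.FinalStateConjecture.Theorems.RenormalisedDriftAdiabaticTracking

open Literature.Geometry.Lorentzian
open Summit.FinalStateConjecture.FinalStateConjecture.Theses
open Summit.FinalStateConjecture.FinalStateConjecture.Theses.RenormalisedDrift
  (AdiabaticTracking DriftCapture MGHDExists)

/-! ## §1 Crux level -/

/-- **The line's composition in hypothetical form** (`AdiabaticTracking_of` of the registered
skeleton `Cruxes/AdiabaticTracking/Lines/birth.lean`, the four stub signatures verbatim as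
hypotheses): MGHD existence (S0) pointwise turns tame genericity of "every MGHD censored and tracked"
into tame genericity of the crux's property (`IsTameChristodoulouGeneric.mono`); local genericity
suffices (`isTameChristodoulouGeneric_of_local`); through an exceptional datum: censored ⇒ S3;
violating ⇒ S1 gives a locally censoring curve, `exists_tameCurve_of_local` makes it censoring at
every `c ≠ 0`, S2 lands it in the tracked regime. [folklore] -/
theorem adiabaticTracking_of_legs
    (hM : ∀ (X : Type) [TopologicalSpace X] [ChartedSpace E3 X] [IsManifold (𝓡 3) ((⊤ : ℕ∞) : WithTop ℕ∞) X] [T2Space X] [SecondCountableTopology X] [ConnectedSpace X], ∀ D ∈ admissibleVacuumData X, ∃ 𝒟 : VacuumCauchyDevelopment D, 𝒟.IsMaximal)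
    (hW : ∀ (X : Type) [TopologicalSpace X] [ChartedSpace E3 X] [IsManifold (𝓡 3) ((⊤ : ℕ∞) : WithTop ℕ∞) X] [T2Space X] [SecondCountableTopology X] [ConnectedSpace X], ∀ D ∈ admissibleVacuumData X, (∃ 𝒟 : VacuumCauchyDevelopment D, 𝒟.IsMaximal ∧ ¬ Summit.FinalStateConjecture.HasCompleteNullInfinity 𝒟.toCauchyDevelopment) → ∃ (e : AFEnd X) (F : EuclideanSpace ℝ (Fin 1) → InitialDataSet (𝓡 3) X), InitialDataSet.IsTameDataFamily e 1 F ∧ InitialDataSet.IsImmersedAtZero 1 F ∧ F 0 = D ∧ Function.Injective F ∧ (∀ c, F c ∈ admissibleVacuumData X) ∧ ∃ ε > (0 : ℝ), ∀ c, c ≠ 0 → ‖c‖ < ε → ∀ 𝒟 : VacuumCauchyDevelopment (F c), 𝒟.IsMaximal → Summit.FinalStateConjecture.HasCompleteNullInfinity 𝒟.toCauchyDevelopment)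
    (hL : ∀ (X : Type) [TopologicalSpace X] [ChartedSpace E3 X] [IsManifold (𝓡 3) ((⊤ : ℕ∞) : WithTop ℕ∞) X] [T2Space X] [SecondCountableTopology X] [ConnectedSpace X], ∀ (e : AFEnd X) (F : EuclideanSpace ℝ (Fin 1) → InitialDataSet (𝓡 3) X), InitialDataSet.IsTameDataFamily e 1 F → InitialDataSet.IsImmersedAtZero 1 F → Function.Injective F → (∀ c, F c ∈ admissibleVacuumData X) → (∃ 𝒟 : VacuumCauchyDevelopment (F 0), 𝒟.IsMaximal ∧ ¬ Summit.FinalStateConjecture.HasCompleteNullInfinity 𝒟.toCauchyDevelopment) → (∀ c ≠ 0, ∀ 𝒟 : VacuumCauchyDevelopment (F c), 𝒟.IsMaximal → Summit.FinalStateConjecture.HasCompleteNullInfinity 𝒟.toCauchyDevelopment) → ∃ (e' : AFEnd X) (F' : EuclideanSpace ℝ (Fin 1) → InitialDataSet (𝓡 3) X), InitialDataSet.IsTameDataFamily e' 1 F' ∧ InitialDataSet.IsImmersedAtZero 1 F' ∧ F' 0 = F 0 ∧ Function.Injective F' ∧ (∀ c, F' c ∈ admissibleVacuumData X) ∧ ∃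 δ > (0 : ℝ), ∀ c, c ≠ 0 → ‖c‖ < δ → ∀ 𝒟 : VacuumCauchyDevelopment (F' c), 𝒟.IsMaximal → Summit.FinalStateConjecture.HasCompleteNullInfinity 𝒟.toCauchyDevelopment ∧ ∃ (N : ℕ) (m₀ χ : ℝ), 0 < m₀ ∧ 0 ≤ χ ∧ χ < 1 ∧ ∀ (L : ℝ) (ε : ENNReal) (R₀ : ℝ), 0 < L → 0 < ε → 𝒟.IsAdiabaticallyTracked N m₀ χ ε L R₀)
    (hT : ∀ (X : Type) [TopologicalSpace X] [ChartedSpace E3 X] [IsManifold (𝓡 3) ((⊤ : ℕ∞) : WithTop ℕ∞) X] [T2Space X] [SecondCountableTopology X] [ConnectedSpace X], ∀ D ∈ admissibleVacuumData X, (∀ 𝒟 : VacuumCauchyDevelopment D, 𝒟.IsMaximal → Summit.FinalStateConjecture.HasCompleteNullInfinity 𝒟.toCauchyDevelopment) → ¬ (∀ 𝒟 : VacuumCauchyDevelopment D, 𝒟.IsMaximal → Summit.FinalStateConjecture.HasCompleteNullInfinity 𝒟.toCauchyDevelopment ∧ ∃ (N : ℕ) (m₀ χ : ℝ), 0 < m₀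 ∧ 0 ≤ χ ∧ χ < 1 ∧ ∀ (L : ℝ) (ε : ENNReal) (R₀ : ℝ), 0 < L → 0 < ε → 𝒟.IsAdiabaticallyTracked N m₀ χ ε L R₀) → ∃ (e : AFEnd X) (F : EuclideanSpace ℝ (Fin 1) → InitialDataSet (𝓡 3) X), InitialDataSet.IsTameDataFamily e 1 F ∧ InitialDataSet.IsImmersedAtZero 1 F ∧ F 0 = D ∧ Function.Injective F ∧ (∀ c, F c ∈ admissibleVacuumData X) ∧ ∃ δ > (0 : ℝ), ∀ c, c ≠ 0 → ‖c‖ < δ → ∀ 𝒟 : VacuumCauchyDevelopment (F c), 𝒟.IsMaximal → Summit.FinalStateConjecture.HasCompleteNullInfinity 𝒟.toCauchyDevelopment ∧ ∃ (N : ℕ) (m₀ χ : ℝ), 0 < m₀ ∧ 0 ≤ χ ∧ χ < 1 ∧ ∀ (L : ℝ) (ε : ENNReal) (R₀ : ℝ), 0 < L → 0 < ε → 𝒟.IsAdiabaticallyTracked N m₀ χ ε L R₀) :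
    AdiabaticTracking := by
  intro X _ _ _ _ _ _
  -- (1)+(2) S0 pointwise: tame genericity of "every MGHD censored and tracked" suffices
  suffices hgen : InitialDataSet.IsTameChristodoulouGeneric (admissibleVacuumData X)
      (fun D ↦ ∀ 𝒟 : VacuumCauchyDevelopment D, 𝒟.IsMaximal →
        Summit.FinalStateConjecture.HasCompleteNullInfinity 𝒟.toCauchyDevelopment ∧
          ∃ (N : ℕ) (m₀ χ : ℝ), 0 < m₀ ∧ 0 ≤ χ ∧ χ < 1 ∧ ∀ (L : ℝ) (ε : ENNReal) (R₀ : ℝ),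
            0 < L → 0 < ε → 𝒟.IsAdiabaticallyTracked N m₀ χ ε L R₀) 1 from
    hgen.mono fun D hD h ↦ ⟨hM X D hD, h⟩
  -- (3) LOCAL witnesses suffice (radial reparametrisation of the parameter line)
  refine InitialDataSet.isTameChristodoulouGeneric_of_local fun d hd hbad ↦ ?_
  by_cases hc : ∀ 𝒟 : VacuumCauchyDevelopment d, 𝒟.IsMaximal →
      Summit.FinalStateConjecture.HasCompleteNullInfinity 𝒟.toCauchyDevelopment
  · -- (3a) censored but not pure: escape from the untracked walls inside the censored class (S3)
    exact hT X d hd hc hbad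
  · -- (3b) violating: a locally censoring curve (S1) …
    have hV : ∃ 𝒟 : VacuumCauchyDevelopment d, 𝒟.IsMaximal ∧
        ¬ Summit.FinalStateConjecture.HasCompleteNullInfinity 𝒟.toCauchyDevelopment := by
      by_contra h
      apply hc
      intro 𝒟 h𝒟
      by_contra h'
      exact h ⟨𝒟, h𝒟, h'⟩
    obtain ⟨e, F, hF, himm, h0, hinj, hadm, ε, hε, hcens⟩ := hW X d hd hV
    -- … made censoring at every `c ≠ 0` (TameGenericityLocal) …
    obtain ⟨e₁, F₁, hF₁, h0₁, hinj₁, himm₁, hadm₁, hcens₁⟩ :=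
      InitialDataSet.exists_tameCurve_of_local
        (P := fun D ↦ ∀ 𝒟 : VacuumCauchyDevelopment D, 𝒟.IsMaximal →
          Summit.FinalStateConjecture.HasCompleteNullInfinity 𝒟.toCauchyDevelopment)
        hF h0 hinj himm hadm hε hcens
    -- … and landed in the tracked regime (S2); its base datum `F₁ 0 = d` is violating
    subst h0₁
    exact hL X e₁ F₁ hF₁ himm₁ hinj₁ hadm₁ hV hcens₁

/-- **Necessity record: the crux implies item stmt-17269** (`PhaseMixingCapture.WeakCosmicCensorshipTame`,
tame weak cosmic censorship in MGHD form): forget the tracking conjunct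
(`IsTameChristodoulouGeneric.mono`, same end and same witness curve). [folklore] -/
theorem weakCosmicCensorshipTame_of_adiabaticTracking (h : AdiabaticTracking) :
    PhaseMixingCapture.WeakCosmicCensorshipTame := by
  intro X _ _ _ _ _ _
  exact (h X).mono fun D _ hP ↦ ⟨hP.1, fun 𝒟 h𝒟 ↦ (hP.2 𝒟 h𝒟).1⟩

/-- **Necessity record: the crux implies item stmt-9952** (`PhaseMixingCapture.WeakCosmicCensorshipMGHD`,
the topology-free genericity form): tame genericity implies plain Christodoulou genericity
(`IsTameChristodoulouGeneric.isChristodoulouGeneric`). [folklore] -/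
theorem weakCosmicCensorshipMGHD_of_adiabaticTracking (h : AdiabaticTracking) :
    PhaseMixingCapture.WeakCosmicCensorshipMGHD :=
  fun X _ _ _ _ _ _ ↦ (weakCosmicCensorshipTame_of_adiabaticTracking h X).isChristodoulouGeneric

/-- **Summit ∧ window bridge ⇒ crux.** Granted the WINDOW BRIDGE (module docstring; written out as
the hypothesis `hB`: an MGHD of an admissible datum with complete `𝓘⁺` that settles down honestly is
adiabatically tracked at every accuracy with one complexity), the summit `FinalStateConjecture`
implies `AdiabaticTracking` pointwise on the good set, hence generically by monotonicity of tame
genericity (same end, same witness curve). The bridge is the converse companion of `DriftCapture`; it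
is paper geometry (late co-moving flat coordinates, causal character of the certified leaves), not a
formal consequence of `FinalStateDecomposition`, and is NOT asserted here. [folklore] -/
theorem adiabaticTracking_of_finalStateConjecture_of_windowBridge
    (hB : ∀ (X : Type) [TopologicalSpace X] [ChartedSpace E3 X] [IsManifold (𝓡 3) ((⊤ : ℕ∞) : WithTop ℕ∞) X] [T2Space X] [SecondCountableTopology X] [ConnectedSpace X], ∀ D ∈ admissibleVacuumData X, ∀ 𝒟 : VacuumCauchyDevelopment D, 𝒟.IsMaximal → Summit.FinalStateConjecture.HasCompleteNullInfinity 𝒟.toCauchyDevelopment → (∃ (O : Set 𝒟.carrier) (d : FinalStateDecomposition 𝒟.toSpacetime O 2), (∀ i, Kerr.IsSubextremal (d.mass i) (d.spin i)) ∧ O = Summit.FinalStateConjecture.exteriorOf 𝒟.toCauchyDevelopment d.charted ∧ Summit.FinalStateConjecture.RaysStayInClosure 𝒟.toCauchyDevelopment O ∧ Summit.FinalStateConjecture.HasExhaustiveCharts d ∧ Summit.FinalStateConjecture.IsFutureOriented d) → ∃ (N : ℕ) (m₀ χ : ℝ), 0 < m₀ ∧ 0 ≤ χ ∧ χ < 1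 ∧ ∀ (L : ℝ) (ε : ENNReal) (R₀ : ℝ), 0 < L → 0 < ε → 𝒟.IsAdiabaticallyTracked N m₀ χ ε L R₀)
    (h : _root_.FinalStateConjecture) : AdiabaticTracking := by
  intro X _ _ _ _ _ _
  exact (h X).mono fun D hD hP ↦ ⟨hP.1, fun 𝒟 h𝒟 ↦
    ⟨(hP.2 𝒟 h𝒟).1, hB X D hD 𝒟 h𝒟 (hP.2 𝒟 h𝒟).1 (hP.2 𝒟 h𝒟).2⟩⟩

/-- **Modulo the two converse bridges the crux IS the summit**: granted the window bridge
(settles honestly ⇒ tracked at every accuracy) and this route's rank-2 crux `DriftCapture` (tracked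
at every accuracy ⇒ settles honestly), `AdiabaticTracking ↔ FinalStateConjecture` — forward by the
route's deciding theorem `RenormalisedDrift.closes`, backward by
`adiabaticTracking_of_finalStateConjecture_of_windowBridge`. [folklore] -/
theorem adiabaticTracking_iff_finalStateConjecture
    (hB : ∀ (X : Type) [TopologicalSpace X] [ChartedSpace E3 X] [IsManifold (𝓡 3) ((⊤ : ℕ∞) : WithTop ℕ∞) X] [T2Space X] [SecondCountableTopology X] [ConnectedSpace X], ∀ D ∈ admissibleVacuumData X, ∀ 𝒟 : VacuumCauchyDevelopment D, 𝒟.IsMaximal → Summit.FinalStateConjecture.HasCompleteNullInfinity 𝒟.toCauchyDevelopment → (∃ (O : Set 𝒟.carrier) (d : FinalStateDecomposition 𝒟.toSpacetime O 2), (∀ i, Kerr.IsSubextremal (d.mass i) (d.spin i)) ∧ O = Summit.FinalStateConjecture.exteriorOf 𝒟.toCauchyDevelopment d.charted ∧ Summit.FinalStateConjecture.RaysStayInClosure 𝒟.toCauchyDevelopment O ∧ Summit.FinalStateConjecture.HasExhaustiveCharts d ∧ Summit.FinalStateConjecture.IsFutureOriented d) → ∃ (N : ℕ) (m₀ χ :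 ℝ), 0 < m₀ ∧ 0 ≤ χ ∧ χ < 1 ∧ ∀ (L : ℝ) (ε : ENNReal) (R₀ : ℝ), 0 < L → 0 < ε → 𝒟.IsAdiabaticallyTracked N m₀ χ ε L R₀)
    (hD : DriftCapture) : AdiabaticTracking ↔ _root_.FinalStateConjecture :=
  ⟨RenormalisedDrift.closes hD, adiabaticTracking_of_finalStateConjecture_of_windowBridge hB⟩

/-- **The crux from the TangentProfileCensorship items and the window bridge, by name**
(cross-route record: RenormalisedDrift rank 3 ⇐ window bridge ∧ stmt-9937 ∧ stmt-17383 ∧ stmt-17348,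
the deciding theorem `TangentProfileCensorship.closes` followed by
`adiabaticTracking_of_finalStateConjecture_of_windowBridge`). [folklore] -/
theorem adiabaticTracking_of_tameExits_of_windowBridge
    (hB : ∀ (X : Type) [TopologicalSpace X] [ChartedSpace E3 X] [IsManifold (𝓡 3) ((⊤ : ℕ∞) : WithTop ℕ∞) X] [T2Space X] [SecondCountableTopology X] [ConnectedSpace X], ∀ D ∈ admissibleVacuumData X, ∀ 𝒟 : VacuumCauchyDevelopment D, 𝒟.IsMaximal → Summit.FinalStateConjecture.HasCompleteNullInfinity 𝒟.toCauchyDevelopment → (∃ (O : Set 𝒟.carrier) (d : FinalStateDecomposition 𝒟.toSpacetime O 2), (∀ i, Kerr.IsSubextremal (d.mass i) (d.spin i)) ∧ O = Summit.FinalStateConjecture.exteriorOf 𝒟.toCauchyDevelopment d.charted ∧ Summit.FinalStateConjecture.RaysStayInClosure 𝒟.toCauchyDevelopment O ∧ Summit.FinalStateConjecture.HasExhaustiveCharts d ∧ Summit.FinalStateConjecture.IsFutureOriented d) → ∃ (N : ℕ) (m₀ χ : ℝ), 0 < m₀ ∧ 0 ≤ χ ∧ χ < 1 ∧ ∀ (L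 : ℝ) (ε : ENNReal) (R₀ : ℝ), 0 < L → 0 < ε → 𝒟.IsAdiabaticallyTracked N m₀ χ ε L R₀)
    (hM : TangentProfileCensorship.MGHDExistence) (hA : TangentProfileCensorship.NakedDataTameExit)
    (hC : TangentProfileCensorship.CensoredDataTameExit) : AdiabaticTracking :=
  adiabaticTracking_of_finalStateConjecture_of_windowBridge hB (TangentProfileCensorship.closes hM hA hC)

/-! ## §2 Stub S0 (`stub_mghdExists`, registered signature verbatim) -/

/-- **S0 is this route's item stmt-9937 verbatim** (`RenormalisedDrift.MGHDExists`, shared by the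
`MGHDExistence` / `MGHDExists` items of the summit's routes). [folklore] -/
theorem stub_mghdExists_iff_mghdExists :
    (∀ (X : Type) [TopologicalSpace X] [ChartedSpace E3 X] [IsManifold (𝓡 3) ((⊤ : ℕ∞) : WithTop ℕ∞) X] [T2Space X] [SecondCountableTopology X] [ConnectedSpace X], ∀ D ∈ admissibleVacuumData X, ∃ 𝒟 : VacuumCauchyDevelopment D, 𝒟.IsMaximal) ↔ MGHDExists :=
  Iff.rfl

/-- **S0 is also route TangentProfileCensorship's item stmt-9937 verbatim** (`MGHDExistence`, the
hypothesis of `adiabaticTracking_of_tameExits_of_windowBridge`). [folklore] -/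
theorem stub_mghdExists_iff_mghdExistence :
    (∀ (X : Type) [TopologicalSpace X] [ChartedSpace E3 X] [IsManifold (𝓡 3) ((⊤ : ℕ∞) : WithTop ℕ∞) X] [T2Space X] [SecondCountableTopology X] [ConnectedSpace X], ∀ D ∈ admissibleVacuumData X, ∃ 𝒟 : VacuumCauchyDevelopment D, 𝒟.IsMaximal) ↔ TangentProfileCensorship.MGHDExistence :=
  Iff.rfl

/-- **S0 from the Choquet-Bruhat–Geroch named fact** (one line:
`choquetBruhat_geroch_exists_mghd_cauchy.forall_mem_admissibleVacuumData`). The stub is thereby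
CONDITIONAL on the unproved tree fact; it closes when `choquetBruhat_geroch_exists_mghd_cauchy_holds`
lands. [cite: ChoquetBruhatGeroch1969CMP, Thm. 3 (p. 332)] -/
theorem stub_mghdExists_of_choquetBruhatGeroch (h : choquetBruhat_geroch_exists_mghd_cauchy) :
    ∀ (X : Type) [TopologicalSpace X] [ChartedSpace E3 X] [IsManifold (𝓡 3) ((⊤ : ℕ∞) : WithTop ℕ∞) X] [T2Space X] [SecondCountableTopology X] [ConnectedSpace X], ∀ D ∈ admissibleVacuumData X, ∃ 𝒟 : VacuumCauchyDevelopment D, 𝒟.IsMaximal :=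
  h.forall_mem_admissibleVacuumData

/-! ## §3 Stub S1 (`stub_weakCosmicCensorship`, registered signature verbatim — the LOCAL expanded
form: through a violating admissible datum, a tame immersed injective admissible curve whose SMALL
members are censored) -/

/-- **S1 is necessary**: the crux implies it (a violating datum is exceptional for the crux's
property; project goodness of the crux's own witness curve to censorship; `ε = 1`). [folklore] -/
theorem stub_weakCosmicCensorship_of_adiabaticTracking (h : AdiabaticTracking) :
    ∀ (X : Type) [TopologicalSpace X] [ChartedSpace E3 X] [IsManifold (𝓡 3) ((⊤ : ℕ∞) : WithTop ℕ∞) X] [T2Space X] [SecondCountableTopology X] [ConnectedSpace X], ∀ D ∈ admissibleVacuumData X, (∃ 𝒟 : VacuumCauchyDevelopment D, 𝒟.IsMaximal ∧ ¬ Summit.FinalStateConjecture.HasCompleteNullInfinity 𝒟.toCauchyDevelopment) → ∃ (e : AFEnd X) (F : EuclideanSpace ℝ (Fin 1) → InitialDataSet (𝓡 3) X), InitialDataSet.IsTameDataFamily e 1 F ∧ InitialDataSet.IsImmersedAtZero 1 F ∧ F 0 = D ∧ Function.Injective F ∧ (∀ c, F c ∈ admissibleVacuumData X) ∧ ∃ ε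 > (0 : ℝ), ∀ c, c ≠ 0 → ‖c‖ < ε → ∀ 𝒟 : VacuumCauchyDevelopment (F c), 𝒟.IsMaximal → Summit.FinalStateConjecture.HasCompleteNullInfinity 𝒟.toCauchyDevelopment :=
  fun X _ _ _ _ _ _ D hD hV ↦ by
    obtain ⟨𝒟₀, h𝒟₀, hnc⟩ := hV
    obtain ⟨e, F, hF, himm, h0, hinj, hadm, hE⟩ := h X D ⟨hD, fun hG ↦ hnc (hG.2 𝒟₀ h𝒟₀).1⟩
    refine ⟨e, F, hF, himm, h0, hinj, hadm, 1, one_pos, fun c hc _ 𝒟 h𝒟 ↦ ?_⟩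
    by_contra hI
    exact hE c hc ⟨hadm c, fun hG ↦ hI (hG.2 𝒟 h𝒟).1⟩

/-- **S1 from item stmt-17269** (`PhaseMixingCapture.WeakCosmicCensorshipTame`): a violating datum
is exceptional for tame weak cosmic censorship, whose (global) witness curve censors every member off
`0`; `ε = 1`. [folklore] -/
theorem stub_weakCosmicCensorship_of_weakCosmicCensorshipTame
    (h : PhaseMixingCapture.WeakCosmicCensorshipTame) :
    ∀ (X : Type) [TopologicalSpace X] [ChartedSpace E3 X] [IsManifold (𝓡 3) ((⊤ : ℕ∞) : WithTop ℕ∞) X] [T2Space X] [SecondCountableTopology X] [ConnectedSpace X], ∀ D ∈ admissibleVacuumData X, (∃ 𝒟 : VacuumCauchyDevelopment D, 𝒟.IsMaximal ∧ ¬ Summit.FinalStateConjecture.HasCompleteNullInfinity 𝒟.toCauchyDevelopment) → ∃ (e : AFEnd X) (F : EuclideanSpace ℝ (Fin 1) → InitialDataSet (𝓡 3) X), InitialDataSet.IsTameDataFamily e 1 F ∧ InitialDataSet.IsImmersedAtZero 1 F ∧ F 0 = D ∧ Function.Injective F ∧ (∀ c, F c ∈ admissibleVacuumData X) ∧ ∃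 ε > (0 : ℝ), ∀ c, c ≠ 0 → ‖c‖ < ε → ∀ 𝒟 : VacuumCauchyDevelopment (F c), 𝒟.IsMaximal → Summit.FinalStateConjecture.HasCompleteNullInfinity 𝒟.toCauchyDevelopment :=
  fun X _ _ _ _ _ _ D hD hV ↦ by
    obtain ⟨𝒟₀, h𝒟₀, hnc⟩ := hV
    obtain ⟨e, F, hF, himm, h0, hinj, hadm, hE⟩ := h X D ⟨hD, fun hG ↦ hnc (hG.2 𝒟₀ h𝒟₀)⟩
    refine ⟨e, F, hF, himm, h0, hinj, hadm, 1, one_pos, fun c hc _ 𝒟 h𝒟 ↦ ?_⟩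
    by_contra hI
    exact hE c hc ⟨hadm c, fun hG ↦ hI (hG.2 𝒟 h𝒟)⟩

/-- **S1 from item stmt-17383** (`TangentProfileCensorship.NakedDataTameExit`): the exit at a
violating datum is a tame immersed injective admissible curve whose small members are good in the
summit's sense, in particular censored. [folklore] -/
theorem stub_weakCosmicCensorship_of_nakedDataTameExit
    (h : TangentProfileCensorship.NakedDataTameExit) :
    ∀ (X : Type) [TopologicalSpace X] [ChartedSpace E3 X] [IsManifold (𝓡 3) ((⊤ : ℕ∞) : WithTop ℕ∞) X] [T2Space X] [SecondCountableTopology X] [ConnectedSpace X], ∀ D ∈ admissibleVacuumData X, (∃ 𝒟 : VacuumCauchyDevelopment D, 𝒟.IsMaximal ∧ ¬ Summit.FinalStateConjecture.HasCompleteNullInfinity 𝒟.toCauchyDevelopment) → ∃ (e : AFEnd X) (F : EuclideanSpace ℝ (Fin 1) → InitialDataSet (𝓡 3) X), InitialDataSet.IsTameDataFamily e 1 F ∧ InitialDataSet.IsImmersedAtZero 1 F ∧ F 0 = D ∧ Function.Injective F ∧ (∀ c, F c ∈ admissibleVacuumData X) ∧ ∃ ε > (0 : ℝ), ∀ c, c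 ≠ 0 → ‖c‖ < ε → ∀ 𝒟 : VacuumCauchyDevelopment (F c), 𝒟.IsMaximal → Summit.FinalStateConjecture.HasCompleteNullInfinity 𝒟.toCauchyDevelopment :=
  fun X _ _ _ _ _ _ D hD hV ↦ by
    obtain ⟨e, F, hF, himm, h0, hinj, hadm, ε, hε, hgood⟩ := h X D hD hV
    exact ⟨e, F, hF, himm, h0, hinj, hadm, ε, hε,
      fun c hc hcε 𝒟 h𝒟 ↦ ((hgood c hc hcε).2 𝒟 h𝒟).1⟩

/-! ## §4 Stub S2 (`stub_trackedLandingAlongCensoredCurves`, registered signature verbatim) -/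

/-- **S2 is necessary**: the crux implies it (ignore the given censored curve: the violating base
datum is exceptional for the crux's property, and the crux's own witness curve through it lands;
`δ = 1`). [folklore] -/
theorem stub_trackedLandingAlongCensoredCurves_of_adiabaticTracking (h : AdiabaticTracking) :
    ∀ (X : Type) [TopologicalSpace X] [ChartedSpace E3 X] [IsManifold (𝓡 3) ((⊤ : ℕ∞) : WithTop ℕ∞) X] [T2Space X] [SecondCountableTopology X] [ConnectedSpace X], ∀ (e : AFEnd X) (F : EuclideanSpace ℝ (Fin 1) → InitialDataSet (𝓡 3) X), InitialDataSet.IsTameDataFamily e 1 F → InitialDataSet.IsImmersedAtZero 1 F → Function.Injective F → (∀ c, F c ∈ admissibleVacuumData X) → (∃ 𝒟 : VacuumCauchyDevelopment (F 0), 𝒟.IsMaximal ∧ ¬ Summit.FinalStateConjecture.HasCompleteNullInfinity 𝒟.toCauchyDevelopment) → (∀ c ≠ 0, ∀ 𝒟 : VacuumCauchyDevelopment (F c), 𝒟.IsMaximal → Summit.FinalStateConjecture.HasCompleteNullInfinity 𝒟.toCauchyDevelopment) → ∃ (e' : AFEnd X) (F' : EuclideanSpace ℝ (Fin 1) → InitialDataSet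 (𝓡 3) X), InitialDataSet.IsTameDataFamily e' 1 F' ∧ InitialDataSet.IsImmersedAtZero 1 F' ∧ F' 0 = F 0 ∧ Function.Injective F' ∧ (∀ c, F' c ∈ admissibleVacuumData X) ∧ ∃ δ > (0 : ℝ), ∀ c, c ≠ 0 → ‖c‖ < δ → ∀ 𝒟 : VacuumCauchyDevelopment (F' c), 𝒟.IsMaximal → Summit.FinalStateConjecture.HasCompleteNullInfinity 𝒟.toCauchyDevelopment ∧ ∃ (N : ℕ) (m₀ χ : ℝ), 0 < m₀ ∧ 0 ≤ χ ∧ χ < 1 ∧ ∀ (L : ℝ) (ε : ENNReal) (R₀ : ℝ), 0 < L → 0 < ε → 𝒟.IsAdiabaticallyTracked N m₀ χ ε L R₀ :=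
  fun X _ _ _ _ _ _ e F _ _ _ hadm hV _ ↦ by
    obtain ⟨𝒟₀, h𝒟₀, hnc⟩ := hV
    obtain ⟨e', F', hF', himm', h0', hinj', hadm', hE⟩ :=
      h X (F 0) ⟨hadm 0, fun hG ↦ hnc (hG.2 𝒟₀ h𝒟₀).1⟩
    refine ⟨e', F', hF', himm', h0', hinj', hadm', 1, one_pos, fun c hc _ ↦ ?_⟩
    have hG := Classical.byContradiction fun hn ↦ hE c hc ⟨hadm' c, hn⟩
    exact hG.2

/-- **S2 from item stmt-17383 and the window bridge**: the base datum `F 0` of the given censored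
curve is violating, so the exit of `NakedDataTameExit` at `F 0` is a tame immersed injective
admissible curve through it whose small members are good in the summit's sense; the window bridge
turns "settles honestly" into "tracked at every accuracy" member by member, MGHD by MGHD. The given
curve, its end and its censoring are not used. [folklore] -/
theorem stub_trackedLandingAlongCensoredCurves_of_nakedDataTameExit_of_windowBridge
    (hB : ∀ (X : Type) [TopologicalSpace X] [ChartedSpace E3 X] [IsManifold (𝓡 3) ((⊤ : ℕ∞) : WithTop ℕ∞) X] [T2Space X] [SecondCountableTopology X] [ConnectedSpace X], ∀ D ∈ admissibleVacuumData X, ∀ 𝒟 : VacuumCauchyDevelopment D, 𝒟.IsMaximal → Summit.FinalStateConjecture.HasCompleteNullInfinity 𝒟.toCauchyDevelopment → (∃ (O : Set 𝒟.carrier) (d : FinalStateDecomposition 𝒟.toSpacetime O 2), (∀ i, Kerr.IsSubextremal (d.mass i) (d.spin i)) ∧ O = Summit.FinalStateConjecture.exteriorOf 𝒟.toCauchyDevelopment d.charted ∧ Summit.FinalStateConjecture.RaysStayInClosure 𝒟.toCauchyDevelopment O ∧ Summit.FinalStateConjecture.HasExhaustiveCharts d ∧ Summit.FinalStateConjecture.IsFutureOriented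 d) → ∃ (N : ℕ) (m₀ χ : ℝ), 0 < m₀ ∧ 0 ≤ χ ∧ χ < 1 ∧ ∀ (L : ℝ) (ε : ENNReal) (R₀ : ℝ), 0 < L → 0 < ε → 𝒟.IsAdiabaticallyTracked N m₀ χ ε L R₀)
    (h : TangentProfileCensorship.NakedDataTameExit) :
    ∀ (X : Type) [TopologicalSpace X] [ChartedSpace E3 X] [IsManifold (𝓡 3) ((⊤ : ℕ∞) : WithTop ℕ∞) X] [T2Space X] [SecondCountableTopology X] [ConnectedSpace X], ∀ (e : AFEnd X) (F : EuclideanSpace ℝ (Fin 1) → InitialDataSet (𝓡 3) X), InitialDataSet.IsTameDataFamily e 1 F → InitialDataSet.IsImmersedAtZero 1 F → Function.Injective F → (∀ c, F c ∈ admissibleVacuumData X) → (∃ 𝒟 : VacuumCauchyDevelopment (F 0), 𝒟.IsMaximal ∧ ¬ Summit.FinalStateConjecture.HasCompleteNullInfinity 𝒟.toCauchyDevelopment) → (∀ c ≠ 0, ∀ 𝒟 : VacuumCauchyDevelopment (F c), 𝒟.IsMaximal → Summit.FinalStateConjecture.HasCompleteNullInfinity 𝒟.toCauchyDevelopment) →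 ∃ (e' : AFEnd X) (F' : EuclideanSpace ℝ (Fin 1) → InitialDataSet (𝓡 3) X), InitialDataSet.IsTameDataFamily e' 1 F' ∧ InitialDataSet.IsImmersedAtZero 1 F' ∧ F' 0 = F 0 ∧ Function.Injective F' ∧ (∀ c, F' c ∈ admissibleVacuumData X) ∧ ∃ δ > (0 : ℝ), ∀ c, c ≠ 0 → ‖c‖ < δ → ∀ 𝒟 : VacuumCauchyDevelopment (F' c), 𝒟.IsMaximal → Summit.FinalStateConjecture.HasCompleteNullInfinity 𝒟.toCauchyDevelopment ∧ ∃ (N : ℕ) (m₀ χ : ℝ), 0 < m₀ ∧ 0 ≤ χ ∧ χ < 1 ∧ ∀ (L : ℝ) (ε : ENNReal) (R₀ : ℝ), 0 < L → 0 < ε → 𝒟.IsAdiabaticallyTracked N m₀ χ ε L R₀ :=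
  fun X _ _ _ _ _ _ e F _ _ _ hadm hV _ ↦ by
    obtain ⟨e', F', hF', himm', h0', hinj', hadm', ε, hε, hgood⟩ := h X (F 0) (hadm 0) hV
    refine ⟨e', F', hF', himm', h0', hinj', hadm', ε, hε, fun c hc hcε 𝒟 h𝒟 ↦ ?_⟩
    exact ⟨((hgood c hc hcε).2 𝒟 h𝒟).1,
      hB X (F' c) (hadm' c) 𝒟 h𝒟 ((hgood c hc hcε).2 𝒟 h𝒟).1 ((hgood c hc hcε).2 𝒟 h𝒟).2⟩

/-! ## §5 Stub S3 (`stub_trackingEscapeInsideCensored`, registered signature verbatim; the hardest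
stub, held by the lead) -/

/-- **S3 is necessary**: the crux implies it (a censored datum with an untracked MGHD is exceptional
for the crux's property; `δ = 1`). [folklore] -/
theorem stub_trackingEscapeInsideCensored_of_adiabaticTracking (h : AdiabaticTracking) :
    ∀ (X : Type) [TopologicalSpace X] [ChartedSpace E3 X] [IsManifold (𝓡 3) ((⊤ : ℕ∞) : WithTop ℕ∞) X] [T2Space X] [SecondCountableTopology X] [ConnectedSpace X], ∀ D ∈ admissibleVacuumData X, (∀ 𝒟 : VacuumCauchyDevelopment D, 𝒟.IsMaximal → Summit.FinalStateConjecture.HasCompleteNullInfinity 𝒟.toCauchyDevelopment) → ¬ (∀ 𝒟 : VacuumCauchyDevelopment D, 𝒟.IsMaximal → Summit.FinalStateConjecture.HasCompleteNullInfinity 𝒟.toCauchyDevelopment ∧ ∃ (N : ℕ) (m₀ χ : ℝ), 0 < m₀ ∧ 0 ≤ χ ∧ χ < 1 ∧ ∀ (L : ℝ) (ε : ENNReal) (R₀ : ℝ), 0 < L → 0 < ε → 𝒟.IsAdiabaticallyTracked N m₀ χ ε L R₀) → ∃ (e : AFEnd X) (F : EuclideanSpace ℝ (Fin 1) → InitialDataSet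 (𝓡 3) X), InitialDataSet.IsTameDataFamily e 1 F ∧ InitialDataSet.IsImmersedAtZero 1 F ∧ F 0 = D ∧ Function.Injective F ∧ (∀ c, F c ∈ admissibleVacuumData X) ∧ ∃ δ > (0 : ℝ), ∀ c, c ≠ 0 → ‖c‖ < δ → ∀ 𝒟 : VacuumCauchyDevelopment (F c), 𝒟.IsMaximal → Summit.FinalStateConjecture.HasCompleteNullInfinity 𝒟.toCauchyDevelopment ∧ ∃ (N : ℕ) (m₀ χ : ℝ), 0 < m₀ ∧ 0 ≤ χ ∧ χ < 1 ∧ ∀ (L : ℝ) (ε : ENNReal) (R₀ : ℝ), 0 < L → 0 < ε → 𝒟.IsAdiabaticallyTracked N m₀ χ ε L R₀ :=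
  fun X _ _ _ _ _ _ D hD _ hbad ↦ by
    obtain ⟨e, F, hF, himm, h0, hinj, hadm, hE⟩ := h X D ⟨hD, fun hG ↦ hbad hG.2⟩
    refine ⟨e, F, hF, himm, h0, hinj, hadm, 1, one_pos, fun c hc _ ↦ ?_⟩
    have hG := Classical.byContradiction fun hn ↦ hE c hc ⟨hadm c, hn⟩
    exact hG.2

/-- **S3 from item stmt-17348 and the window bridge**: a censored datum one of whose MGHDs `𝒟₀` is
not tracked at every accuracy — by the window bridge `𝒟₀` does not settle honestly, so the exit of
`CensoredDataTameExit` applies (MGHD existence at the datum is witnessed by `𝒟₀` itself); its small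
members are good in the summit's sense, and the bridge turns "settles honestly" into "tracked at
every accuracy". So the hardest stub is item stmt-17348 modulo the bridge. [folklore] -/
theorem stub_trackingEscapeInsideCensored_of_censoredDataTameExit_of_windowBridge
    (hB : ∀ (X : Type) [TopologicalSpace X] [ChartedSpace E3 X] [IsManifold (𝓡 3) ((⊤ : ℕ∞) : WithTop ℕ∞) X] [T2Space X] [SecondCountableTopology X] [ConnectedSpace X], ∀ D ∈ admissibleVacuumData X, ∀ 𝒟 : VacuumCauchyDevelopment D, 𝒟.IsMaximal → Summit.FinalStateConjecture.HasCompleteNullInfinity 𝒟.toCauchyDevelopment → (∃ (O : Set 𝒟.carrier) (d : FinalStateDecomposition 𝒟.toSpacetime O 2), (∀ i, Kerr.IsSubextremal (d.mass i) (d.spin i)) ∧ O = Summit.FinalStateConjecture.exteriorOf 𝒟.toCauchyDevelopment d.charted ∧ Summit.FinalStateConjecture.RaysStayInClosure 𝒟.toCauchyDevelopment O ∧ Summit.FinalStateConjecture.HasExhaustiveCharts d ∧ Summit.FinalStateConjecture.IsFutureOriented d) → ∃ (N : ℕ) (m₀ χ : ℝ), 0 < m₀ ∧ 0 ≤ χ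 ∧ χ < 1 ∧ ∀ (L : ℝ) (ε : ENNReal) (R₀ : ℝ), 0 < L → 0 < ε → 𝒟.IsAdiabaticallyTracked N m₀ χ ε L R₀)
    (h : TangentProfileCensorship.CensoredDataTameExit) :
    ∀ (X : Type) [TopologicalSpace X] [ChartedSpace E3 X] [IsManifold (𝓡 3) ((⊤ : ℕ∞) : WithTop ℕ∞) X] [T2Space X] [SecondCountableTopology X] [ConnectedSpace X], ∀ D ∈ admissibleVacuumData X, (∀ 𝒟 : VacuumCauchyDevelopment D, 𝒟.IsMaximal → Summit.FinalStateConjecture.HasCompleteNullInfinity 𝒟.toCauchyDevelopment) → ¬ (∀ 𝒟 : VacuumCauchyDevelopment D, 𝒟.IsMaximal → Summit.FinalStateConjecture.HasCompleteNullInfinity 𝒟.toCauchyDevelopment ∧ ∃ (N : ℕ) (m₀ χ : ℝ), 0 < m₀ ∧ 0 ≤ χ ∧ χ < 1 ∧ ∀ (L : ℝ) (ε : ENNReal) (R₀ : ℝ), 0 < L → 0 < ε → 𝒟.IsAdiabaticallyTracked N m₀ χ ε L R₀) → ∃ (e : AFEnd X) (F : EuclideanSpace ℝ (Fin 1) → InitialDataSet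 (𝓡 3) X), InitialDataSet.IsTameDataFamily e 1 F ∧ InitialDataSet.IsImmersedAtZero 1 F ∧ F 0 = D ∧ Function.Injective F ∧ (∀ c, F c ∈ admissibleVacuumData X) ∧ ∃ δ > (0 : ℝ), ∀ c, c ≠ 0 → ‖c‖ < δ → ∀ 𝒟 : VacuumCauchyDevelopment (F c), 𝒟.IsMaximal → Summit.FinalStateConjecture.HasCompleteNullInfinity 𝒟.toCauchyDevelopment ∧ ∃ (N : ℕ) (m₀ χ : ℝ), 0 < m₀ ∧ 0 ≤ χ ∧ χ < 1 ∧ ∀ (L : ℝ) (ε : ENNReal) (R₀ : ℝ), 0 < L → 0 < ε → 𝒟.IsAdiabaticallyTracked N m₀ χ ε L R₀ :=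
  fun X _ _ _ _ _ _ D hD hC hbad ↦ by
    -- a (censored) MGHD of `D` which is not tracked at every accuracy
    obtain ⟨𝒟₀, h𝒟₀, hn⟩ : ∃ 𝒟 : VacuumCauchyDevelopment D, 𝒟.IsMaximal ∧
        ¬ ∃ (N : ℕ) (m₀ χ : ℝ), 0 < m₀ ∧ 0 ≤ χ ∧ χ < 1 ∧ ∀ (L : ℝ) (ε : ENNReal) (R₀ : ℝ),
          0 < L → 0 < ε → 𝒟.IsAdiabaticallyTracked N m₀ χ ε L R₀ := by
      by_contra hall
      exact hbad fun 𝒟 h𝒟 ↦ ⟨hC 𝒟 h𝒟, Classical.byContradiction fun hn ↦ hall ⟨𝒟, h𝒟, hn⟩⟩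
    -- by the window bridge it does not settle honestly
    have hS : ¬ ∃ (O : Set 𝒟₀.carrier) (d : FinalStateDecomposition 𝒟₀.toSpacetime O 2),
        (∀ i, Kerr.IsSubextremal (d.mass i) (d.spin i)) ∧
          O = Summit.FinalStateConjecture.exteriorOf 𝒟₀.toCauchyDevelopment d.charted ∧
            Summit.FinalStateConjecture.RaysStayInClosure 𝒟₀.toCauchyDevelopment O ∧
              Summit.FinalStateConjecture.HasExhaustiveCharts d ∧
                Summit.FinalStateConjecture.IsFutureOriented d :=
      fun hs ↦ hn (hB X D hD 𝒟₀ h𝒟₀ (hC 𝒟₀ h𝒟₀) hs)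
    obtain ⟨e, F, hF, himm, h0, hinj, hadm, ε, hε, hgood⟩ :=
      h X D hD ⟨𝒟₀, h𝒟₀⟩ hC ⟨𝒟₀, h𝒟₀, hS⟩
    refine ⟨e, F, hF, himm, h0, hinj, hadm, ε, hε, fun c hc hcε 𝒟 h𝒟 ↦ ?_⟩
    exact ⟨((hgood c hc hcε).2 𝒟 h𝒟).1,
      hB X (F c) (hadm c) 𝒟 h𝒟 ((hgood c hc hcε).2 𝒟 h𝒟).1 ((hgood c hc hcε).2 𝒟 h𝒟).2⟩

end Summit.FinalStateConjecture.FinalStateConjecture.Theorems.RenormalisedDriftAdiabaticTracking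

end
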